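import Literature.Geometry.Riemannian.MetricFlowFDistanceTriangle
import Literature.Geometry.Riemannian.MetricFlowFConvergenceTimewise
import Literature.Geometry.Riemannian.MetricFlowFConvergenceMeasures
import HarnessLib

/-!
# `𝔽`-close metric flow pairs have `W₁`-close conjugate heat kernels at nearby points carrying
# mass (Bamler 2023, §5.3, Lemma 5.17)

R. Bamler, *Compactness theory of the space of super Ricci flows*, Invent. Math. 233 (2023), §5.3,
Lemma 5.17 (arXiv v1 Lemma 117, "a bound on the `W₁`-distance between conjugate heat kernels based
at nearby points with respect to a correspondence"): "Let `(𝒳^i, (μ^i_t)_{t ∈ I'^{,i}})`, `i = 1, 2`,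
be metric flow pairs over an interval `I ⊂ ℝ` that are fully defined over some `J ⊂ I` and let
`ℭ = ((Z_t, d^Z_t)_{t ∈ I''}, (φ^i_t)_{t ∈ I''^{,i}, i = 1,2})` be a correspondence between `𝒳¹, 𝒳²`
over `I''` that is also fully defined over `J`. Let `δ, r > 0`. Suppose that
`d_𝔽^{ℭ,J}((𝒳¹, (μ¹_t)_{t ∈ I'^{,1}}), (𝒳², (μ²_t)_{t ∈ I'^{,2}})) ≤ δ r`. Consider times `s, t ∈ J`,
`s ≤ t` and points `x^i ∈ 𝒳^i_t` with `d^Z_t(φ¹_t(x¹), φ²_t(x²)) ≤ r`, `|B(x¹, r)| ≥ 2δ`. Then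
`d_{W₁}^{Z_s}((φ¹_s)_* ν¹_{x¹;s}, (φ²_s)_* ν²_{x²;s}) ≤ 7r`."

This file proves the lemma in the vocabulary of `MetricFlowFDistance.lean`: the left-hand side is
the integrand `MetricFlowPair.kernelDistWithin P₁ P₂ ℭ _ _ _ _ (x¹, x²)` of Definition (`𝔽`-distance
within correspondence), `d_𝔽^{ℭ,J}` is `MetricFlowPair.fDistWithin`, and `|B(x¹, r)|` is
`μ¹_t(B(x¹, r))`.

* `MetricFlowPair.edist_le_kernelDistWithin_self` — at `s = t` the integrand dominates
  `d^Z_t(φ¹_t y¹, φ²_t y²)` (`ν_{y;t} = δ_y`, `d(a, b) ≤ d_{W₁}(δ_a, δ_b)`), the form in which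
  condition (2) of the Definition "for `s = t`" enters the printed proof;
* `MetricFlowPair.kernelDistWithin_le_of_fDistAdmissible` — the lemma for an ADMISSIBLE radius
  `δ r` of `d_𝔽^{ℭ,J}` (`FDistAdmissible`, i.e. the exceptional set `E` and the couplings `(q_t)` of
  the Definition are given outright);
* `MetricFlowPair.kernelDistWithin_le_of_fDistWithin_lt` — **Lemma 5.17**, with the STRICT
  hypothesis `d_𝔽^{ℭ,J} < δ r` (the source: "Due to a limit argument, we may assume that we have
  strict inequality"; then `δ r` is admissible, `exists_fDistAdmissibleWith_of_fDistWithin_lt`) and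
  the CLOSED ball `B̄(x¹, r)` in the mass hypothesis `μ¹_t(B̄(x¹, r)) ≥ 2δ` (weaker than the printed
  one; the printed proof goes through verbatim).

As in `MetricFlowFDistanceTriangle.lean`, the flows are assumed `H`-concentrated (the standing
assumption of Bamler's theory), which provides §3.2 Proposition (c),
`d_{W₁}(ν_{x;s}, ν_{y;s}) ≤ d_t(x, y)`, in the form `IsHConcentrated.wassersteinW1_condKernel_le_edist`
(through `kernelDistWithin_le_add_edist`).

Proof, as printed. Put `d := d_{W₁}^{Z_s}((φ¹_s)_* ν¹_{x¹;s}, (φ²_s)_* ν²_{x²;s})` and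
`S := B̄(x¹, 3r) × B̄(x², 3r) ⊆ 𝒳¹_t × 𝒳²_t`. By Proposition (c) and two `W₁`-triangle inequalities,
`d ≤ d_{W₁}^{Z_s}((φ¹_s)_* ν¹_{y¹;s}, (φ²_s)_* ν²_{y²;s}) + 6r` for `(y¹, y²) ∈ S`, so condition (2)
of the Definition at `(s, t)` gives `d · q_t(S) ≤ δ r + 6r · q_t(S)`. For `y¹ ∈ B̄(x¹, r)` and
`y² ∉ B̄(x², 3r)`, `d^Z_t(φ¹_t y¹, φ²_t y²) ≥ 3r − r − r = r`; by condition (2) at `(t, t)` and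
Markov's inequality the region `{d^Z_t(φ¹_t y¹, φ²_t y²) ≥ r}` has `q_t`-measure `≤ δ r / r = δ`, so
(the first marginal of `q_t` being `μ¹_t`) `q_t(S) ≥ μ¹_t(B̄(x¹, r)) − δ ≥ 2δ − δ = δ`. Hence
`d · q_t(S) ≤ r · q_t(S) + 6r · q_t(S)` with `0 < q_t(S) < ∞`, i.e. `d ≤ 7r`.

## References

* R. H. Bamler, *Compactness theory of the space of super Ricci flows*, Invent. Math. 233 (2023),
  1121–1277 (arXiv:2008.09298), §5.3, Lemma 5.17 (arXiv v1 Lemma 117); §5.1, Definition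
  (`𝔽`-distance within correspondence); §3.2, Proposition (c). [Bamler2023]
-/

noncomputable section

open Set MeasureTheory Filter TopologicalSpace Function
open scoped Topology ENNReal NNReal

namespace Literature.Geometry.Riemannian

universe u

namespace MetricFlowPair

open MetricFlow

variable {I₁ I₂ : Set ℝ} {P₁ : MetricFlowPair.{u} I₁} {P₂ : MetricFlowPair.{u} I₂} {I'' : Set ℝ}

/-- **The integrand at `s = t` dominates the distance in `Z_t`**: for `t ∈ I''^{,1} ∩ I''^{,2}` and
`(y¹, y²) ∈ 𝒳¹_t × 𝒳²_t`,
`d^Z_t(φ¹_t y¹, φ²_t y²) ≤ d_{W₁}^{Z_t}((φ¹_t)_* ν¹_{y¹;t}, (φ²_t)_* ν²_{y²;t})`: `ν_{y;t} = δ_y`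
(`condKernel_self`), `(φ)_* δ_y = δ_{φ y}` and `d(a, b) ≤ d_{W₁}(δ_a, δ_b)`
(`edist_le_wassersteinW1_dirac`). This is how condition (2) of Definition (`𝔽`-distance within
correspondence) "for `s = t`" is used in the proof of Lemma 5.17.
[cite: Bamler2023, §5.3, Lemma 5.17 (arXiv v1 Lemma 117), proof] -/
theorem edist_le_kernelDistWithin_self (ℭ : Correspondence₂ P₁.flow P₂.flow I'') {t : ℝ}
    (ht₁ : t ∈ ℭ.dom₁) (ht₂ : t ∈ ℭ.dom₂)
    (p : P₁.flow.Slice ⟨t, (ℭ.dom₁_subset ht₁).1⟩ × P₂.flow.Slice ⟨t, (ℭ.dom₂_subset ht₂).1⟩) :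
    edist (ℭ.φ₁ t ht₁ p.1) (ℭ.φ₂ t ht₂ p.2) ≤ kernelDistWithin P₁ P₂ ℭ ht₁ ht₂ ht₁ ht₂ p := by
  unfold kernelDistWithin
  rw [P₁.flow.condKernel_self, P₂.flow.condKernel_self,
    Measure.map_dirac' (ℭ.isometry₁ t ht₁).continuous.measurable,
    Measure.map_dirac' (ℭ.isometry₂ t ht₂).continuous.measurable]
  exact edist_le_wassersteinW1_dirac _ _

/-- **Lemma 5.17 for an admissible radius** (Bamler 2023, §5.3, proof of Lemma 5.17): if `δ r`
(`δ, r > 0`) is admissible for `d_𝔽^{ℭ,J}` — an exceptional set `E` avoiding `J` and couplings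
`q_t` of `μ¹_t, μ²_t`, `t ∈ I'' ∖ E`, satisfying condition (2) of Definition (`𝔽`-distance within
correspondence) with `δ r` — and `s ≤ t` lie in `J`, `x^i ∈ 𝒳^i_t` satisfy
`d^Z_t(φ¹_t x¹, φ²_t x²) ≤ r` and `μ¹_t(B̄(x¹, r)) ≥ 2δ`, then
`d_{W₁}^{Z_s}((φ¹_s)_* ν¹_{x¹;s}, (φ²_s)_* ν²_{x²;s}) ≤ 7r`, for `H`-concentrated flows. Printed
proof: on `S := B̄(x¹, 3r) × B̄(x², 3r)` the integrand is `≥ d − 6r` (`kernelDistWithin_le_add_edist`),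
so `d · q_t(S) ≤ δ r + 6r · q_t(S)` (condition (2) at `(s, t)`); the region
`{d^Z_t(φ¹_t y¹, φ²_t y²) ≥ r} ⊇ B̄(x¹, r) × (𝒳²_t ∖ B̄(x², 3r))` has `q_t`-measure `≤ δ` (Markov,
condition (2) at `(t, t)`, `edist_le_kernelDistWithin_self`), so
`q_t(S) ≥ μ¹_t(B̄(x¹, r)) − δ ≥ δ` (`q_t` has first marginal `μ¹_t`), and `d ≤ r + 6r`.
[cite: Bamler2023, §5.3, Lemma 5.17 (arXiv v1 Lemma 117)] -/
theorem kernelDistWithin_le_of_fDistAdmissible {H₁ H₂ : ℝ}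
    (hH₁ : P₁.flow.IsHConcentrated H₁) (hH₂ : P₂.flow.IsHConcentrated H₂)
    (ℭ : Correspondence₂ P₁.flow P₂.flow I'') {J : Set ℝ} (hJ : ℭ.FullyDefinedOver J)
    {δ r : ℝ} (hδ : 0 < δ) (hr : 0 < r) (hadm : FDistAdmissible P₁ P₂ ℭ J (δ * r))
    {s t : ℝ} (hs : s ∈ J) (ht : t ∈ J) (hst : s ≤ t)
    (x₁ : P₁.flow.Slice ⟨t, (ℭ.dom₁_subset (hJ.1 ht)).1⟩)
    (x₂ : P₂.flow.Slice ⟨t, (ℭ.dom₂_subset (hJ.2 ht)).1⟩)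
    (hx : dist (ℭ.φ₁ t (hJ.1 ht) x₁) (ℭ.φ₂ t (hJ.2 ht) x₂) ≤ r)
    (hmass : ENNReal.ofReal (2 * δ) ≤
      P₁.μ ⟨t, (ℭ.dom₁_subset (hJ.1 ht)).1⟩ (Metric.closedBall x₁ r)) :
    kernelDistWithin P₁ P₂ ℭ (hJ.1 hs) (hJ.2 hs) (hJ.1 ht) (hJ.2 ht) (x₁, x₂) ≤
      ENNReal.ofReal (7 * r) := by
  -- the exceptional set `E` (avoiding `J`) and the couplings `q_t` of the admissible radius `δ r`
  obtain ⟨_, E, _, _, hJE, hE₁, hE₂, _, q, hq, hint⟩ := hadm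
  have hsE : s ∈ I'' \ E := hJE hs
  have htE : t ∈ I'' \ E := hJE ht
  haveI : IsProbabilityMeasure (q t htE) := (hq t htE).1
  have h3r : (0 : ℝ) ≤ 3 * r := by positivity
  have hr0 : ENNReal.ofReal r ≠ 0 := (ENNReal.ofReal_pos.2 hr).ne'
  -- notation: the integrand `K` at `(s, t)`, the distance `D` in `Z_t`, the box `S`
  set K : P₁.flow.Slice ⟨t, (ℭ.dom₁_subset (hJ.1 ht)).1⟩ ×
      P₂.flow.Slice ⟨t, (ℭ.dom₂_subset (hJ.2 ht)).1⟩ → ℝ≥0∞ :=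
    fun p ↦ kernelDistWithin P₁ P₂ ℭ (hJ.1 hs) (hJ.2 hs) (hJ.1 ht) (hJ.2 ht) p
  set D : P₁.flow.Slice ⟨t, (ℭ.dom₁_subset (hJ.1 ht)).1⟩ ×
      P₂.flow.Slice ⟨t, (ℭ.dom₂_subset (hJ.2 ht)).1⟩ → ℝ≥0∞ :=
    fun p ↦ edist (ℭ.φ₁ t (hJ.1 ht) p.1) (ℭ.φ₂ t (hJ.2 ht) p.2)
  have hDm : Measurable D :=
    (((ℭ.isometry₁ t (hJ.1 ht)).continuous.comp continuous_fst).edist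
      ((ℭ.isometry₂ t (hJ.2 ht)).continuous.comp continuous_snd)).measurable
  set S : Set (P₁.flow.Slice ⟨t, (ℭ.dom₁_subset (hJ.1 ht)).1⟩ ×
      P₂.flow.Slice ⟨t, (ℭ.dom₂_subset (hJ.2 ht)).1⟩) :=
    Metric.closedBall x₁ (3 * r) ×ˢ Metric.closedBall x₂ (3 * r)
  have hSm : MeasurableSet S := measurableSet_closedBall.prod measurableSet_closedBall
  -- condition (2) of the Definition at `(s, t)` and at `(t, t)`
  have hKint : ∫⁻ p, K p ∂(q t htE) ≤ ENNReal.ofReal (δ * r) := hint s hsE t htE hst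
  have hDint : ∫⁻ p, D p ∂(q t htE) ≤ ENNReal.ofReal (δ * r) :=
    le_trans (lintegral_mono fun p ↦ edist_le_kernelDistWithin_self ℭ (hE₁ htE) (hE₂ htE) p)
      (hint t htE t htE le_rfl)
  -- Markov: the region `{d^Z_t(φ¹_t y¹, φ²_t y²) ≥ r}` has `q_t`-measure `≤ δ r / r = δ`
  have hfar : q t htE {p | ENNReal.ofReal r ≤ D p} ≤ ENNReal.ofReal δ := by
    have h := (mul_meas_ge_le_lintegral₀ hDm.aemeasurable (ENNReal.ofReal r)).trans hDint
    rw [mul_comm δ r, ENNReal.ofReal_mul hr.le] at h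
    exact (ENNReal.mul_le_mul_iff_right hr0 ENNReal.ofReal_ne_top).1 h
  -- `B̄(x¹, r) × 𝒳²_t ⊆ S ∪ {d^Z_t(φ¹_t y¹, φ²_t y²) ≥ r}` (`3r − r − r = r`)
  have hcover : Metric.closedBall x₁ r ×ˢ (univ : Set _) ⊆ S ∪ {p | ENNReal.ofReal r ≤ D p} := by
    intro p hp
    have hp₁ : dist p.1 x₁ ≤ r := Metric.mem_closedBall.1 hp.1
    by_cases hp₂ : p.2 ∈ Metric.closedBall x₂ (3 * r)
    · exact Or.inl ⟨Metric.closedBall_subset_closedBall (by linarith) hp.1, hp₂⟩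
    · refine Or.inr ?_
      have hp₂' : 3 * r < dist p.2 x₂ := lt_of_not_ge fun h ↦ hp₂ (Metric.mem_closedBall.2 h)
      show ENNReal.ofReal r ≤ edist (ℭ.φ₁ t (hJ.1 ht) p.1) (ℭ.φ₂ t (hJ.2 ht) p.2)
      rw [edist_dist]
      refine ENNReal.ofReal_le_ofReal ?_
      have h4 : dist x₂ p.2 ≤ dist (ℭ.φ₁ t (hJ.1 ht) x₁) (ℭ.φ₂ t (hJ.2 ht) x₂) + dist x₁ p.1 +
          dist (ℭ.φ₁ t (hJ.1 ht) p.1) (ℭ.φ₂ t (hJ.2 ht) p.2) := by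
        have h := dist_triangle4 (ℭ.φ₂ t (hJ.2 ht) x₂) (ℭ.φ₁ t (hJ.1 ht) x₁)
          (ℭ.φ₁ t (hJ.1 ht) p.1) (ℭ.φ₂ t (hJ.2 ht) p.2)
        rwa [(ℭ.isometry₂ t (hJ.2 ht)).dist_eq, (ℭ.isometry₁ t (hJ.1 ht)).dist_eq,
          dist_comm (ℭ.φ₂ t (hJ.2 ht) x₂) (ℭ.φ₁ t (hJ.1 ht) x₁)] at h
      rw [dist_comm] at hp₁ hp₂'
      linarith
  -- the first marginal of `q_t` is `μ¹_t`
  have hfst : q t htE (Metric.closedBall x₁ r ×ˢ (univ : Set _)) =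
      P₁.μ ⟨t, (ℭ.dom₁_subset (hJ.1 ht)).1⟩ (Metric.closedBall x₁ r) := by
    rw [Set.prod_univ, ← Measure.fst_apply measurableSet_closedBall, (hq t htE).2.1]
  -- hence `q_t(S) ≥ 2δ − δ = δ`
  have hSδ : ENNReal.ofReal δ ≤ q t htE S := by
    have h : ENNReal.ofReal δ + ENNReal.ofReal δ ≤ q t htE S + ENNReal.ofReal δ :=
      calc ENNReal.ofReal δ + ENNReal.ofReal δ = ENNReal.ofReal (2 * δ) := by
            rw [two_mul, ENNReal.ofReal_add hδ.le hδ.le]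
        _ ≤ P₁.μ ⟨t, (ℭ.dom₁_subset (hJ.1 ht)).1⟩ (Metric.closedBall x₁ r) := hmass
        _ = q t htE (Metric.closedBall x₁ r ×ˢ (univ : Set _)) := hfst.symm
        _ ≤ q t htE (S ∪ {p | ENNReal.ofReal r ≤ D p}) := measure_mono hcover
        _ ≤ q t htE S + q t htE {p | ENNReal.ofReal r ≤ D p} := measure_union_le _ _
        _ ≤ q t htE S + ENNReal.ofReal δ := add_le_add_right hfar _
    exact ENNReal.le_of_add_le_add_right ENNReal.ofReal_ne_top h
  -- pointwise on `S`: `d ≤ d_{W₁}((φ¹_s)_* ν¹_{y¹;s}, (φ²_s)_* ν²_{y²;s}) + 6r` (Proposition (c))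
  have hpt : ∀ p ∈ S, K (x₁, x₂) ≤ K p + ENNReal.ofReal (6 * r) := by
    rintro p ⟨hp₁, hp₂⟩
    have he : edist (x₁, x₂) p ≤ ENNReal.ofReal (3 * r) := by
      rw [Prod.edist_eq]
      refine max_le ?_ ?_
      · show edist x₁ p.1 ≤ _
        rw [edist_comm]
        exact (edist_le_ofReal h3r).2 (Metric.mem_closedBall.1 hp₁)
      · show edist x₂ p.2 ≤ _
        rw [edist_comm]
        exact (edist_le_ofReal h3r).2 (Metric.mem_closedBall.1 hp₂)
    calc K (x₁, x₂) ≤ K p + 2 * edist (x₁, x₂) p :=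
          kernelDistWithin_le_add_edist hH₁ hH₂ ℭ (hJ.1 hs) (hJ.2 hs) (hJ.1 ht) (hJ.2 ht) hst _ _
      _ ≤ K p + ENNReal.ofReal (6 * r) := by
          refine add_le_add_right ?_ _
          calc 2 * edist (x₁, x₂) p = edist (x₁, x₂) p + edist (x₁, x₂) p := two_mul _
            _ ≤ ENNReal.ofReal (3 * r) + ENNReal.ofReal (3 * r) := add_le_add he he
            _ = ENNReal.ofReal (6 * r) := by
                rw [← ENNReal.ofReal_add h3r h3r]
                congr 1
                ring
  -- integrate over `S` against `q_t` (condition (2) at `(s, t)`): `d · q_t(S) ≤ δ r + 6r · q_t(S)`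
  have hI : K (x₁, x₂) * q t htE S ≤
      ENNReal.ofReal (δ * r) + ENNReal.ofReal (6 * r) * q t htE S :=
    calc K (x₁, x₂) * q t htE S = ∫⁻ _ in S, K (x₁, x₂) ∂(q t htE) :=
          (setLIntegral_const S _).symm
      _ ≤ ∫⁻ p in S, K p + ENNReal.ofReal (6 * r) ∂(q t htE) := setLIntegral_mono' hSm hpt
      _ = ∫⁻ p in S, K p ∂(q t htE) + ENNReal.ofReal (6 * r) * q t htE S := by
          rw [lintegral_add_right _ measurable_const, setLIntegral_const]
      _ ≤ ∫⁻ p, K p ∂(q t htE) + ENNReal.ofReal (6 * r) * q t htE S :=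
          add_le_add_left (setLIntegral_le_lintegral S _) _
      _ ≤ ENNReal.ofReal (δ * r) + ENNReal.ofReal (6 * r) * q t htE S :=
          add_le_add_left hKint _
  -- divide by `q_t(S) ∈ [δ, 1]`: `d ≤ δ r / q_t(S) + 6r ≤ r + 6r`
  have hS0 : q t htE S ≠ 0 := ((ENNReal.ofReal_pos.2 hδ).trans_le hSδ).ne'
  have hStop : q t htE S ≠ ∞ := measure_ne_top _ _
  refine (ENNReal.mul_le_mul_iff_left hS0 hStop).1 (hI.trans ?_)
  calc ENNReal.ofReal (δ * r) + ENNReal.ofReal (6 * r) * q t htE S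
      ≤ ENNReal.ofReal r * q t htE S + ENNReal.ofReal (6 * r) * q t htE S := by
        refine add_le_add_left ?_ _
        rw [mul_comm δ r, ENNReal.ofReal_mul hr.le]
        exact mul_le_mul_right hSδ _
    _ = ENNReal.ofReal (7 * r) * q t htE S := by
        rw [← add_mul, ← ENNReal.ofReal_add hr.le (by positivity)]
        congr 2
        ring

/-- **Bamler 2023, Lemma 5.17 (arXiv v1 Lemma 117): `𝔽`-close flows have `W₁`-close conjugate heat
kernels at nearby points carrying mass.** Let `ℭ` be a correspondence between the flows of two
`H`-concentrated metric flow pairs, fully defined over `J`, and `δ, r > 0` with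
`d_𝔽^{ℭ,J}((𝒳¹, (μ¹_t)), (𝒳², (μ²_t))) < δ r`. If `s ≤ t` lie in `J` and `x¹ ∈ 𝒳¹_t`, `x² ∈ 𝒳²_t`
satisfy `d^Z_t(φ¹_t(x¹), φ²_t(x²)) ≤ r` and `μ¹_t(B̄(x¹, r)) ≥ 2δ`, then
`d_{W₁}^{Z_s}((φ¹_s)_* ν¹_{x¹;s}, (φ²_s)_* ν²_{x²;s}) ≤ 7r`. (The source assumes `≤ δ r` and reduces to
the strict inequality "due to a limit argument"; with `<`, the radius `δ r` is admissible outright,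
`exists_fDistAdmissibleWith_of_fDistWithin_lt`, and `kernelDistWithin_le_of_fDistAdmissible`
is the printed proof.) [cite: Bamler2023, §5.3, Lemma 5.17 (arXiv v1 Lemma 117)] -/
theorem kernelDistWithin_le_of_fDistWithin_lt {H₁ H₂ : ℝ}
    (hH₁ : P₁.flow.IsHConcentrated H₁) (hH₂ : P₂.flow.IsHConcentrated H₂)
    (ℭ : Correspondence₂ P₁.flow P₂.flow I'') {J : Set ℝ} (hJ : ℭ.FullyDefinedOver J)
    {δ r : ℝ} (hδ : 0 < δ) (hr : 0 < r)
    (hd : fDistWithin P₁ P₂ ℭ J < ENNReal.ofReal (δ * r))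
    {s t : ℝ} (hs : s ∈ J) (ht : t ∈ J) (hst : s ≤ t)
    (x₁ : P₁.flow.Slice ⟨t, (ℭ.dom₁_subset (hJ.1 ht)).1⟩)
    (x₂ : P₂.flow.Slice ⟨t, (ℭ.dom₂_subset (hJ.2 ht)).1⟩)
    (hx : dist (ℭ.φ₁ t (hJ.1 ht) x₁) (ℭ.φ₂ t (hJ.2 ht) x₂) ≤ r)
    (hmass : ENNReal.ofReal (2 * δ) ≤
      P₁.μ ⟨t, (ℭ.dom₁_subset (hJ.1 ht)).1⟩ (Metric.closedBall x₁ r)) :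
    kernelDistWithin P₁ P₂ ℭ (hJ.1 hs) (hJ.2 hs) (hJ.1 ht) (hJ.2 ht) (x₁, x₂) ≤
      ENNReal.ofReal (7 * r) := by
  obtain ⟨E, hE⟩ := exists_fDistAdmissibleWith_of_fDistWithin_lt (mul_pos hδ hr) hd
  exact kernelDistWithin_le_of_fDistAdmissible hH₁ hH₂ ℭ hJ hδ hr hE.fDistAdmissible hs ht hst
    x₁ x₂ hx hmass

end MetricFlowPair

end Literature.Geometry.Riemannian

end
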